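import Summits.AtomisticToContinuum.FouriersLaw.Theorems.OddSectorIrreversibilityWitnessGlueTapLeakGlue
import Summits.AtomisticToContinuum.FouriersLaw.Theorems.OddSectorIrreversibilityConeScaleCorrectorStubCorrectorWitnessBoundSqrtN

/-!
# `ConeScaleCorrector` (E1), line Sketch: the witness jaw (W′) from the two sibling cruxes `P` and `E2`

Support file for crux stmt-AtomisticToContinuum-14069 (`OddSectorIrreversibility.ConeScaleCorrector`, E1), line
`Sketch` (card `memory-time-bootstrap`), registered stub `stub_correctorWitnessBound` (W′):
`∫ u·J_tot dμ_T ≤ K₁‖u‖_{L²(μ_T)}√Z + K₂·N·Z` for every a.e.-limit `u ∈ L²(μ_T)` of the finite-horizon Kubo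
correctors, with `K₁, K₂` independent of `N` (`μ_T = OddSectorLocality.gibbsWeight`, mass `Z`).

PROVED HERE CONDITIONALLY on the two EXISTING sibling cruxes of the route, `P = TapLeakBound` (stmt-15159) and
`E2 = SubBallisticWindow` (stmt-14070): `stub_correctorWitnessBound_of_cruxes : TapLeakBound → SubBallisticWindow → (W′)`
(registered sub-goal of the item). The proof is a COROLLARY of the landed one-`N` block estimate
`OddSectorWitness.TapLeak.response_bound_of_tapLeak` (`…WitnessGlueTapLeakBlock.lean`): that theorem takes `E1`
at one `N` as a hypothesis `∫u² ≤ C₁N²Z` with `C₁ ≥ 0` a free real and the Green–Kubo pairing as `⟨u,J⟩ =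
Z(N-1)T²D` with `D` a free real, so at a fixed `N ≥ 16` we may take `C₁ := ∫u²/(N²Z)` and
`D := ⟨u,J⟩/(Z(N-1)T²)`; its conclusion `D ≤ 2(64√(C₁C₂(1+a))/a + aγC√2/2)/T² + (4aγCT)²/T⁴` then reads
`⟨u,J⟩ ≤ (128√(C₂(1+a))/a)·‖u‖√Z·(N-1)/N + (aγC√2 + 16a²γ²C²)(N-1)Z`, which is (W′). For `N < 16` the landed
Cauchy–Schwarz form `stub_correctorWitnessBound_sqrtN` (`⟨u,J⟩ ≤ K√N‖u‖√Z`, `√N < 4`) suffices. The a.e.-limit `u`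
of the statement is identified `μ_T`-a.e. with the `C¹` corrector of the PROVED support `CorrectorTheory`
(limits are unique), to which `P` applies.

Reading: with this file the registered skeleton of E1 (line Sketch) is `E1 ⟸ (M) ∧ P ∧ E2` by name — the
memory-time bound (M) `stub_memoryTimeBound` is the line's only stub that is not an existing item.
No route statement is asserted unconditionally; nothing here closes the crux.
-/

noncomputable section

open MeasureTheory ProbabilityTheory Filter Topology Set
open scoped ENNReal NNReal BigOperators
open Literature.MathematicalPhysics.KineticTheory.HeatConduction
open Summit.AtomisticToContinuum.FouriersLaw.Theorems.ClosedConeSensitivity.Negative.ZeroFrictionDictionary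
open Summit.AtomisticToContinuum.FouriersLaw.Theorems.OddSectorWitness
open Summit.AtomisticToContinuum.FouriersLaw.Theorems.OddSectorWitness.TapLeak

namespace Summit.AtomisticToContinuum.FouriersLaw.Theorems.OddSectorIrreversibility

/-- The real-arithmetic core: if `D ≤ 2(64√(C₁C₂')/a + c₅)/T² + c₄²T²/T⁴` with `G = Z(N-1)T²D`,
`C₁ = r²`, `Z r = √Z √I / N`, then `G ≤ (128√C₂'/a) √I √Z + (2c₅ + c₄²) N Z` (`N ≥ 1`, `Z, T > 0`,
`r, c₅ ≥ 0`). [folklore] -/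
theorem pairing_le_of_response_le {D G Z T a r C₂' c₄ c₅ I : ℝ} {N : ℕ} (hN : 1 ≤ N) (hZ : 0 < Z)
    (hT : 0 < T) (ha : 0 < a) (hr : 0 ≤ r) (hc₅ : 0 ≤ c₅)
    (hG : G = Z * (((N : ℝ) - 1) * T ^ 2 * D))
    (hrZ : Z * r = Real.sqrt Z * Real.sqrt I / N)
    (hD : D ≤ 2 * (64 * Real.sqrt (r ^ 2 * C₂') / a + c₅) / T ^ 2 + (c₄ * T) ^ 2 / T ^ 4) :
    G ≤ 128 * Real.sqrt C₂' / a * Real.sqrt I * Real.sqrt Z + (2 * c₅ + c₄ ^ 2) * N * Z := by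
  have hNr : (1 : ℝ) ≤ N := by exact_mod_cast hN
  have hN0 : (0 : ℝ) < N := by linarith
  have hN1 : (0 : ℝ) ≤ (N : ℝ) - 1 := by linarith
  have hsq : Real.sqrt (r ^ 2 * C₂') = r * Real.sqrt C₂' := by
    rw [Real.sqrt_mul (sq_nonneg r), Real.sqrt_sq hr]
  rw [hsq] at hD
  -- clear the powers of `T`
  have hD' : T ^ 2 * D ≤ 128 * (r * Real.sqrt C₂') / a + 2 * c₅ + c₄ ^ 2 := by
    have hT2 : 0 < T ^ 2 := by positivity
    have h1 : T ^ 2 * (2 * (64 * (r * Real.sqrt C₂') / a + c₅) / T ^ 2) = 128 * (r * Real.sqrt C₂') / a + 2 * c₅ := by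
      field_simp; ring
    have h2 : T ^ 2 * ((c₄ * T) ^ 2 / T ^ 4) = c₄ ^ 2 := by
      field_simp
    have := mul_le_mul_of_nonneg_left hD hT2.le
    rw [mul_add, h1, h2] at this
    linarith
  -- multiply by `Z (N-1) ≥ 0`
  have hM0 : 0 ≤ Z * ((N : ℝ) - 1) := mul_nonneg hZ.le hN1
  have hG' : G = Z * ((N : ℝ) - 1) * (T ^ 2 * D) := by rw [hG]; ring
  have h3 : G ≤ Z * ((N : ℝ) - 1) * (128 * (r * Real.sqrt C₂') / a + 2 * c₅ + c₄ ^ 2) := by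
    rw [hG']; exact mul_le_mul_of_nonneg_left hD' hM0
  -- the `r`-term: `Z (N-1) r = (N-1)/N · √Z √I ≤ √Z √I`
  have hSS : 0 ≤ Real.sqrt Z * Real.sqrt I := mul_nonneg (Real.sqrt_nonneg _) (Real.sqrt_nonneg _)
  have h4 : Z * ((N : ℝ) - 1) * r ≤ Real.sqrt Z * Real.sqrt I := by
    have e : Z * ((N : ℝ) - 1) * r = ((N : ℝ) - 1) / N * (Real.sqrt Z * Real.sqrt I) := by
      rw [show Z * ((N : ℝ) - 1) * r = ((N : ℝ) - 1) * (Z * r) by ring, hrZ]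
      field_simp
    rw [e]
    have hfrac : ((N : ℝ) - 1) / N ≤ 1 := by
      rw [div_le_one hN0]; linarith
    calc ((N : ℝ) - 1) / N * (Real.sqrt Z * Real.sqrt I) ≤ 1 * (Real.sqrt Z * Real.sqrt I) :=
          mul_le_mul_of_nonneg_right hfrac hSS
      _ = Real.sqrt Z * Real.sqrt I := one_mul _
  have hk0 : 0 ≤ 128 * Real.sqrt C₂' / a := by positivity
  have h5 : Z * ((N : ℝ) - 1) * (128 * (r * Real.sqrt C₂') / a) ≤ 128 * Real.sqrt C₂' / a * Real.sqrt I * Real.sqrt Z := by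
    calc Z * ((N : ℝ) - 1) * (128 * (r * Real.sqrt C₂') / a) = (128 * Real.sqrt C₂' / a) * (Z * ((N : ℝ) - 1) * r) := by ring
      _ ≤ (128 * Real.sqrt C₂' / a) * (Real.sqrt Z * Real.sqrt I) := mul_le_mul_of_nonneg_left h4 hk0
      _ = 128 * Real.sqrt C₂' / a * Real.sqrt I * Real.sqrt Z := by ring
  have h6 : Z * ((N : ℝ) - 1) * (2 * c₅ + c₄ ^ 2) ≤ (2 * c₅ + c₄ ^ 2) * N * Z := by
    have hc : 0 ≤ 2 * c₅ + c₄ ^ 2 := by positivity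
    have : Z * ((N : ℝ) - 1) ≤ Z * N := mul_le_mul_of_nonneg_left (by linarith) hZ.le
    calc Z * ((N : ℝ) - 1) * (2 * c₅ + c₄ ^ 2) ≤ Z * N * (2 * c₅ + c₄ ^ 2) := mul_le_mul_of_nonneg_right this hc
      _ = (2 * c₅ + c₄ ^ 2) * N * Z := by ring
  calc G ≤ Z * ((N : ℝ) - 1) * (128 * (r * Real.sqrt C₂') / a + 2 * c₅ + c₄ ^ 2) := h3
    _ = Z * ((N : ℝ) - 1) * (128 * (r * Real.sqrt C₂') / a) + Z * ((N : ℝ) - 1) * (2 * c₅ + c₄ ^ 2) := by ring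
    _ ≤ _ := add_le_add h5 h6

/-- **(W′) from the sibling cruxes** (`stub_correctorWitnessBound_of_cruxes`, registered sub-goal): `TapLeakBound → SubBallisticWindow →` (for all admissible parameters and
`T > 0` there are `K₁, K₂` with, for every `N` and every a.e.-limit `u ∈ L²(μ_T)` of the finite-horizon Kubo
correctors, `∫ u·J_tot dμ_T ≤ K₁‖u‖_{L²(μ_T)}√Z + K₂·N·Z`) — the registered stub `stub_correctorWitnessBound` of
line Sketch of crux E1 `ConeScaleCorrector`, verbatim, as a corollary of the landed one-`N` block estimate
`response_bound_of_tapLeak` with `C₁ := ∫u²/(N²Z)`, `D := ⟨u,J⟩/(Z(N-1)T²)` (`N ≥ 16`; `N < 16` by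
`stub_correctorWitnessBound_sqrtN`); constants `K₁ = 128√(max C₂ 0 (1+a))/a + 4K`,
`K₂ = aγ(max C 0)√2 + (4aγ max C 0)²`. [folklore] -/
theorem stub_correctorWitnessBound_of_cruxes :
    Summit.AtomisticToContinuum.FouriersLaw.Theses.OddSectorIrreversibility.TapLeakBound →
    Summit.AtomisticToContinuum.FouriersLaw.Theses.OddSectorIrreversibility.SubBallisticWindow →
    ∀ ω₂ lam β γ : ℝ, 0 < ω₂ → 0 < lam → 0 < β → 0 < γ → ∀ T : ℝ, 0 < T → ∃ K₁ K₂ : ℝ,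
      ∀ (N : ℕ) (u : Literature.MathematicalPhysics.KineticTheory.HeatConduction.PhaseSpace N → ℝ),
      (∀ᵐ x ∂(Literature.MathematicalPhysics.KineticTheory.OddSectorLocality.gibbsWeight ω₂ lam β γ T N),
        Filter.Tendsto (fun τ : ℝ => ∫ t in Set.Ioc (0 : ℝ) τ,
          Literature.MathematicalPhysics.KineticTheory.OddSectorLocality.currentForecast ω₂ lam β γ T N t x)
          Filter.atTop (nhds (u x))) →
      MeasureTheory.MemLp u 2 (Literature.MathematicalPhysics.KineticTheory.OddSectorLocality.gibbsWeight ω₂ lam β γ T N) →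
      ∫ x, u x * (∑ i : Fin N,
          (Literature.MathematicalPhysics.KineticTheory.HeatConduction.pinnedChain ω₂ lam β γ).bondCurrent N i x)
          ∂(Literature.MathematicalPhysics.KineticTheory.OddSectorLocality.gibbsWeight ω₂ lam β γ T N) ≤
        K₁ * Real.sqrt (∫ x, (u x) ^ 2
            ∂(Literature.MathematicalPhysics.KineticTheory.OddSectorLocality.gibbsWeight ω₂ lam β γ T N)) *
          Real.sqrt (∫ x, Real.exp
            (-((Literature.MathematicalPhysics.KineticTheory.HeatConduction.pinnedChain ω₂ lam β γ).hamiltonian N x) / T)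
            ∂MeasureTheory.volume) +
        K₂ * (N : ℝ) * ∫ x, Real.exp
            (-((Literature.MathematicalPhysics.KineticTheory.HeatConduction.pinnedChain ω₂ lam β γ).hamiltonian N x) / T)
            ∂MeasureTheory.volume := by
  intro hP hE2 ω₂ lam β γ hω hl hβ hγ T hT
  obtain ⟨a, C, ha, hPN⟩ := hP ω₂ lam β γ hω hl hβ hγ T hT
  obtain ⟨C₂, hE2N⟩ := hE2 ω₂ lam β γ hω hl hβ hγ T hT
  obtain ⟨K, hK0, hK⟩ := stub_correctorWitnessBound_sqrtN ω₂ lam β γ hω hl.le hβ.le T hT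
  set Cp : ℝ := max C 0 with hCp
  set C₂p : ℝ := max C₂ 0 with hC₂p
  have hCp0 : 0 ≤ Cp := le_max_right _ _
  have hC₂p0 : 0 ≤ C₂p := le_max_right _ _
  refine ⟨128 * Real.sqrt (C₂p * (1 + a)) / a + 4 * K,
    2 * (a * γ * Cp * Real.sqrt 2 / 2) + (4 * a * γ * Cp) ^ 2, fun N u hu hu2 => ?_⟩
  -- the two spellings of the Gibbs weight agree definitionally
  have hμ : Literature.MathematicalPhysics.KineticTheory.OddSectorLocality.gibbsWeight ω₂ lam β γ T N =
      gibbsWeight ω₂ lam β γ N T := rfl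
  rw [hμ] at hu hu2 ⊢
  set Z : ℝ := ∫ x, Real.exp (-((pinnedChain ω₂ lam β γ).hamiltonian N x) / T) ∂volume with hZdef
  have hZ : 0 < Z := integral_exp_pos (pinnedChain_integrable_gibbsDensity hω hl.le hβ.le γ N hT)
  set I : ℝ := ∫ x, (u x) ^ 2 ∂(gibbsWeight ω₂ lam β γ N T) with hIdef
  have hI0 : 0 ≤ I := integral_nonneg fun _ => sq_nonneg _
  have hk₁0 : 0 ≤ 128 * Real.sqrt (C₂p * (1 + a)) / a := by positivity
  have hk₂0 : 0 ≤ 2 * (a * γ * Cp * Real.sqrt 2 / 2) + (4 * a * γ * Cp) ^ 2 := by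
    have := hγ.le; positivity
  have hSS : 0 ≤ Real.sqrt I * Real.sqrt Z := mul_nonneg (Real.sqrt_nonneg _) (Real.sqrt_nonneg _)
  rcases Nat.lt_or_ge N 16 with hN | hN
  · -- small `N`: one Cauchy–Schwarz against `J_tot` (`√N < 4`)
    have h := hK N u hu2
    rw [hμ, ← hIdef, ← hZdef] at h
    have hsN : Real.sqrt (N : ℝ) ≤ 4 := by
      rw [show (4 : ℝ) = Real.sqrt (4 ^ 2) by rw [Real.sqrt_sq (by norm_num)]]
      exact Real.sqrt_le_sqrt (by exact_mod_cast (by omega : N ≤ 16))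
    have h1 : K * Real.sqrt (N : ℝ) * Real.sqrt I * Real.sqrt Z ≤ 4 * K * Real.sqrt I * Real.sqrt Z := by
      have : K * Real.sqrt (N : ℝ) ≤ 4 * K := by nlinarith [hK0, hsN, Real.sqrt_nonneg (N : ℝ)]
      calc K * Real.sqrt (N : ℝ) * Real.sqrt I * Real.sqrt Z = (K * Real.sqrt (N : ℝ)) * (Real.sqrt I * Real.sqrt Z) := by ring
        _ ≤ (4 * K) * (Real.sqrt I * Real.sqrt Z) := mul_le_mul_of_nonneg_right this hSS
        _ = 4 * K * Real.sqrt I * Real.sqrt Z := by ring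
    have h2 : 0 ≤ 128 * Real.sqrt (C₂p * (1 + a)) / a * Real.sqrt I * Real.sqrt Z := by positivity
    have h3 : 0 ≤ (2 * (a * γ * Cp * Real.sqrt 2 / 2) + (4 * a * γ * Cp) ^ 2) * (N : ℝ) * Z :=
      mul_nonneg (mul_nonneg hk₂0 (Nat.cast_nonneg N)) hZ.le
    calc _ ≤ K * Real.sqrt (N : ℝ) * Real.sqrt I * Real.sqrt Z := h
      _ ≤ 4 * K * Real.sqrt I * Real.sqrt Z := h1
      _ ≤ 4 * K * Real.sqrt I * Real.sqrt Z + (128 * Real.sqrt (C₂p * (1 + a)) / a * Real.sqrt I * Real.sqrt Z +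
          (2 * (a * γ * Cp * Real.sqrt 2 / 2) + (4 * a * γ * Cp) ^ 2) * (N : ℝ) * Z) :=
          le_add_of_nonneg_right (add_nonneg h2 h3)
      _ = _ := by ring
  · -- large `N`: the block estimate with `C₁ := I/(N²Z)`, `D := ⟨u,J⟩/(Z(N-1)T²)`
    have hNpos : 0 < N := by omega
    obtain ⟨v, hv1, hv2, hv3, hv4, h5, h6, h7⟩ :=
      Corrector.CorrectorTheory_proof.1 ω₂ lam β γ hω hl hβ hγ T hT N
    simp only [] at hv1 hv2 hv3 hv4 h5 h6 h7
    -- the a.e.-limit `u` IS the corrector `v`, a.e.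
    have hae : u =ᵐ[gibbsWeight ω₂ lam β γ N T] v := by
      have hv3' : ∀ᵐ x ∂(gibbsWeight ω₂ lam β γ N T), Filter.Tendsto (fun τ : ℝ => ∫ t in Set.Ioc (0 : ℝ) τ,
          Literature.MathematicalPhysics.KineticTheory.OddSectorLocality.currentForecast ω₂ lam β γ T N t x)
          Filter.atTop (nhds (v x)) := hv3
      filter_upwards [hu, hv3'] with x hx hx'
      exact tendsto_nhds_unique hx hx'
    have hGeq : ∫ x, u x * (∑ i : Fin N, (pinnedChain ω₂ lam β γ).bondCurrent N i x) ∂(gibbsWeight ω₂ lam β γ N T) =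
        ∫ x, v x * (∑ i : Fin N, (pinnedChain ω₂ lam β γ).bondCurrent N i x) ∂(gibbsWeight ω₂ lam β γ N T) :=
      integral_congr_ae (by filter_upwards [hae] with x hx; rw [hx])
    have hIeq : I = ∫ x, (v x) ^ 2 ∂(gibbsWeight ω₂ lam β γ N T) :=
      integral_congr_ae (by filter_upwards [hae] with x hx; rw [hx])
    rw [hGeq]
    set G : ℝ := ∫ x, v x * (∑ i : Fin N, (pinnedChain ω₂ lam β γ).bondCurrent N i x) ∂(gibbsWeight ω₂ lam β γ N T)
      with hGdef
    have hN2 : (16 : ℝ) ≤ N := by exact_mod_cast hN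
    have hN1 : 0 < (N : ℝ) - 1 := by linarith
    have hNr : (0 : ℝ) < N := by linarith
    -- the free constants of the one-`N` theorem
    set D : ℝ := G / (Z * (((N : ℝ) - 1) * T ^ 2)) with hDdef
    set r : ℝ := Real.sqrt I / ((N : ℝ) * Real.sqrt Z) with hrdef
    have hr0 : 0 ≤ r := by positivity
    have hsZ : 0 < Real.sqrt Z := Real.sqrt_pos.2 hZ
    have hGK : G = Z * (((N : ℝ) - 1) * T ^ 2 * D) := by
      rw [hDdef]; field_simp
    have hE1 : ∫ x, (v x) ^ 2 ∂(gibbsWeight ω₂ lam β γ N T) ≤ r ^ 2 * (N : ℝ) ^ 2 * Z := by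
      rw [← hIeq, hrdef, div_pow, mul_pow, Real.sq_sqrt hI0, Real.sq_sqrt hZ.le]
      refine le_of_eq ?_
      field_simp
    have hrZ : Z * r = Real.sqrt Z * Real.sqrt I / N := by
      have hZZ : Real.sqrt Z * Real.sqrt Z = Z := Real.mul_self_sqrt hZ.le
      rw [hrdef]
      nth_rewrite 1 [← hZZ]
      field_simp
    -- the two contacts
    set b₀ : Fin N := ⟨0, by omega⟩ with hb₀def
    set b₁ : Fin N := ⟨N - 1, by omega⟩ with hb₁def
    -- the closed-flow bond currents, kernel form and flow form
    set jt : Fin N → ℝ → PhaseSpace N → ℝ := fun i s x =>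
      ∫ y, (pinnedChain ω₂ lam β γ).bondCurrent N i y ∂((pinnedChain ω₂ lam β 0).transitionKernel N T T s.toNNReal x)
      with hjtdef
    have hjt : ∀ i s x, jt i s x = (pinnedChain ω₂ lam β γ).bondCurrent N i (detFlow ω₂ lam β N ((s.toNNReal : ℝ≥0) : ℝ) x) :=
      fun i s x => integral_transitionKernel_zero_friction hω hl.le hβ.le N T T s.toNNReal x _
    -- E2 at this `N`, in `window` form
    have hE2' : ∀ k₁ k₂ : ℕ, k₁ ≤ k₂ → k₂ + 1 ≤ N → ∀ τ : ℝ, 0 ≤ τ →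
        ∫ x, (window ω₂ lam β γ N k₁ k₂ τ x) ^ 2 ∂(gibbsWeight ω₂ lam β γ N T) ≤
          C₂p * (1 + τ) * ((k₂ : ℝ) - k₁) * ∫ x, Real.exp (-((pinnedChain ω₂ lam β γ).hamiltonian N x) / T) ∂volume := by
      intro k₁ k₂ hk hk₂ τ hτ
      have h := hE2N N k₁ k₂ hk hk₂ τ hτ
      simp only [] at h
      have hw : ∀ x, (window ω₂ lam β γ N k₁ k₂ τ x) ^ 2 =
          (∫ t in Ioc (0 : ℝ) τ, ∫ y, (∑ i : Fin N, (if k₁ ≤ i.val ∧ i.val < k₂ then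
            (pinnedChain ω₂ lam β γ).bondCurrent N i y else 0)) ∂((pinnedChain ω₂ lam β 0).transitionKernel N T T t.toNNReal x)) ^ 2 :=
        fun x => by rw [kernelWindow_eq_window hω hl.le hβ.le]
      have hwi := integral_congr_ae (μ := gibbsWeight ω₂ lam β γ N T) (Eventually.of_forall hw)
      rw [hwi]
      refine h.trans ?_
      have hkk : (0 : ℝ) ≤ (k₂ : ℝ) - k₁ := by
        have : (k₁ : ℝ) ≤ k₂ := by exact_mod_cast hk
        linarith
      have hfac : 0 ≤ (1 + τ) * ((k₂ : ℝ) - k₁) * ∫ x, Real.exp (-((pinnedChain ω₂ lam β γ).hamiltonian N x) / T) ∂volume := by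
        positivity
      nlinarith [le_max_left C₂ 0, hfac]
    -- P at this `N` and the corrector `v`
    have hP' : ∀ (i b : Fin N), (b.val = 0 ∨ b.val = N - 1) → ∀ s : ℝ, 0 ≤ s →
        s ≤ a * ((if b.val = 0 then i.val else N - 2 - i.val : ℕ) : ℝ) →
        |T * ∫ x, partialP b (fun y : PhaseSpace N => (v y + v (y.1, -y.2)) / 2) x * partialP b (jt i s) x
            ∂(gibbsWeight ω₂ lam β γ N T)| ≤
          Cp * Real.sqrt ((|∫ x, v x * (∑ k : Fin N, (pinnedChain ω₂ lam β γ).bondCurrent N k x) ∂(gibbsWeight ω₂ lam β γ N T)| +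
              ∫ x, Real.exp (-((pinnedChain ω₂ lam β γ).hamiltonian N x) / T) ∂volume) *
            ∫ x, Real.exp (-((pinnedChain ω₂ lam β γ).hamiltonian N x) / T) ∂volume) /
          (1 + ((((if b.val = 0 then i.val else N - 2 - i.val : ℕ) : ℝ)) - s / a)) ^ (3 / 2 : ℝ) := by
      intro i b hb s hs0 hsd
      have h := hPN N i b v s hb hs0
      simp only [] at h
      have h' := h hv1 hv2 hv3 hsd
      refine h'.trans ?_
      have hbase : 0 ≤ 1 + ((((if b.val = 0 then i.val else N - 2 - i.val : ℕ) : ℝ)) - s / a) := by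
        have : s / a ≤ ((if b.val = 0 then i.val else N - 2 - i.val : ℕ) : ℝ) := by
          rw [div_le_iff₀ ha]; linarith
        linarith
      refine div_le_div_of_nonneg_right ?_ (Real.rpow_nonneg hbase _)
      exact mul_le_mul_of_nonneg_right (le_max_left _ _) (Real.sqrt_nonneg _)
    -- the one-`N` response bound with the free constants so chosen
    have hbound := response_bound_of_tapLeak hω hl.le hβ.le γ N hT hγ ha hCp0 (sq_nonneg r)
      hC₂p0 hN hv2 h5 b₀ b₁ rfl rfl (h6 b₀ b₁ rfl rfl) jt hjt
      (fun i t ht => h7 i b₀ b₁ t rfl rfl ht) hP' hGK hE1 hE2'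
    -- unpack: `√(r² C₂p (1+a))` and the real arithmetic
    have hD : D ≤ 2 * (64 * Real.sqrt (r ^ 2 * (C₂p * (1 + a))) / a + a * γ * Cp * Real.sqrt 2 / 2) / T ^ 2 +
        (4 * a * γ * Cp * T) ^ 2 / T ^ 4 := by
      have := hbound.2
      rwa [show r ^ 2 * C₂p * (1 + a) = r ^ 2 * (C₂p * (1 + a)) by ring] at this
    have hc₅ : 0 ≤ a * γ * Cp * Real.sqrt 2 / 2 := by have := hγ.le; positivity
    have hmain := pairing_le_of_response_le (N := N) (by omega) hZ hT ha hr0 hc₅ hGK hrZ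
      (by rwa [show (4 * a * γ * Cp * T) = (4 * a * γ * Cp) * T by ring] at hD)
    -- `I` back in terms of `u`, and the extra `4K` in `K₁`
    have h4K : 0 ≤ 4 * K * Real.sqrt I * Real.sqrt Z := by positivity
    calc G ≤ 128 * Real.sqrt (C₂p * (1 + a)) / a * Real.sqrt I * Real.sqrt Z +
          (2 * (a * γ * Cp * Real.sqrt 2 / 2) + (4 * a * γ * Cp) ^ 2) * N * Z := hmain
      _ ≤ 128 * Real.sqrt (C₂p * (1 + a)) / a * Real.sqrt I * Real.sqrt Z +
          (2 * (a * γ * Cp * Real.sqrt 2 / 2) + (4 * a * γ * Cp) ^ 2) * N * Z + 4 * K * Real.sqrt I * Real.sqrt Z :=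
          le_add_of_nonneg_right h4K
      _ = _ := by ring

end Summit.AtomisticToContinuum.FouriersLaw.Theorems.OddSectorIrreversibility

end
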